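import Summits.CriticalPhenomena.PercolationContinuityZ3.Theorems.Transplant.FKConnectivityAllQForestContractionMono
import Summits.CriticalPhenomena.PercolationContinuityZ3.Theorems.Transplant.FKConnectivityAllQFastEvalBridgeGen
import Summits.CriticalPhenomena.PercolationContinuityZ3.Theorems.Transplant.FKConnectivityAllQForestSquareCex
import HarnessLib

/-!
# KERNEL REFUTATION of every-pair contraction monotonicity: `¬ AdjForestContractionMonoOn (Fin 9)`, `¬ AdjForestContractionMonoPos`
# — pinning the keystone pair of the two-fan graph RAISES the adjacent forest Rayleigh margin from 2 to 4

Support file (`--supports stmt-CriticalPhenomena-4575`), FK sub-lane `prim-bschramm-fk-1` (gen 24) of the post-continuity programme;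
builds on p205010 (kernel theorem, internal audit signed; external expert review pending).  One listed graph (definition), no named facts,
no sorries; standard axioms (`decide +kernel` on the verified fast evaluator of `…FastEval*.lean`; no `native_decide`).

THE NODE REFUTED.  `AdjForestContractionMonoOn V` (`…ForestContractionMono`, this generation): for EVERY fibre `(M,u₀)`, `e = ov ≠ f = oy` and
EVERY free pair `g ∉ {e,f}`, `bad(M,u₀) + good(M∖g, u₀+g) ≤ good(M,u₀) + bad(M∖g, u₀+g)` (pinning `g` does not raise `margin = good − bad`).
THE WITNESS (kit j193252 = exhaustive census over all connected graphs with 9 vertices, 29,466,208 (G, o, {e,f}, g) tests, exactly ONE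
failure; second engine numerics/hub4/cex9.py; memo bschramm/FROM-fk-1-g24-HUB-EVENT-CALCULUS.md §A.1): `G` on `{0,…,8}` with pairs
`02 12 03 13 05 45 06 46 27 57 38 68 | 78 | 01 04` (listed in this order: twelve free pairs, the keystone `g = 78` (index 12), `e = 01` (13),
`f = 04` (14)); hub `o = 0` with two fans `{1; 2,3}`, `{4; 5,6}`, outer vertices `7 ~ 2,5`, `8 ~ 3,6`.  At the top fibre (all 15 pairs free,
`u₀ = ∅`): `bad = 526`, `good = 528` (margin 2); at the fibre with `g` pinned: `bad = 96`, `good = 100` (margin 4 > 2).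
THE CERTIFICATE.  Both fibres are read on GUARDED fibres (`fibreCount_insert_two_both / _one`): the top fibre on `(conf (firstT 13), ∅)`
(`fibreCount_conf_eq_card_bool`, masks `a < 2¹³`), the pinned fibre on `(conf (tOf 4095), conf (tOf 4096))` (`fibreCount_conf_tOf_eq_card_bool`,
masks `a ⊆ 4095`); forest conditions are read as `forestB` of the mask with the bits of `e, f, g` set (`conf_lor_*`); one weighted binary-split
sum per fibre, `Σ ([bad a] + 2ᵏ[good a])` = 8651278 = 526 + 2¹⁴·528 resp. 6553696 = 96 + 2¹⁶·100 (`decide +kernel` in chunks of 2¹¹), decodes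
the four counts; `526 + 100 ≤ 528 + 96` is false.
* **`not_adjForestContractionMonoOn_fin_nine : ¬ AdjForestContractionMonoOn (Fin 9)`**, **`not_adjForestContractionMonoPos`**.
refuted-substantive FOR THE EVERY-PAIR FORM ONLY: on the witness every other free pair is pinnable without raising the margin, so the SOME-PAIR
form (hypothesis of `adjForestRayleighNoSqOn_of_exists_pinning`, `…ForestPinningInduction`) and the node (♣)⁰ itself are untouched.
Census: n ≤ 8: 0 / 1,716,144; n = 9: 1 / 29,466,208; n = 10, m ≤ 15: 0 / 85,040,472.
[cite: SempleWelsh2008, Conj. 1.1 (p. 2); Thm. 4.2 (p. 11)] [cite: CibulkaHladkyLaCroixWagner2008, Thm. 1 (p. 2)] [cite: Linusson2011, Prop. 2.6]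
-/

namespace Summit.CriticalPhenomena.PercolationContinuityZ3.Theorems

namespace FK

open Literature.Probability.LatticeModels Literature.Probability.Percolation
open scoped symmDiff

/-- **The witness graph** on `Fin 9`: listed pairs `0..11` free and far from the statement, `12 = g = (7,8)` (the keystone),
`13 = e = (0,1)`, `14 = f = (0,4)`; parameters unused (`0`), `q = 1`. (kit j193252; memo bschramm/FROM-fk-1-g24-HUB-EVENT-CALCULUS.md §A.1) -/
abbrev cmD : RCEval where
  n := 9
  m := 15
  src := ![0, 1, 0, 1, 0, 4, 0, 4, 2, 5, 3, 6, 7, 0, 0]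
  dst := ![2, 2, 3, 3, 5, 5, 6, 6, 7, 7, 8, 8, 8, 1, 4]
  c := fun _ => 0
  q := 1

namespace ContractionMonoCex

open RCEval

/-! ### The data -/

/-- The data is valid (pairs distinct). [folklore] -/
theorem valid : cmD.Valid := by decide +kernel

/-- No listed loop. [folklore] -/
theorem noloop : ∀ i, cmD.src i ≠ cmD.dst i := by decide +kernel

/-- Listed pair `12` is `g = s(7,8)`. [folklore] -/
theorem edge_twelve : cmD.edge 12 = s((7 : Fin 9), 8) := by decide +kernel

/-- Listed pair `13` is `e = s(0,1)`. [folklore] -/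
theorem edge_thirteen : cmD.edge 13 = s((0 : Fin 9), 1) := by decide +kernel

/-- Listed pair `14` is `f = s(0,4)`. [folklore] -/
theorem edge_fourteen : cmD.edge 14 = s((0 : Fin 9), 4) := by decide +kernel

/-- The mask `2¹²` opens exactly the keystone. [folklore] -/
theorem tOf_g : cmD.tOf 4096 = {12} := by decide +kernel

/-- The mask `2¹³` opens exactly `e`. [folklore] -/
theorem tOf_e : cmD.tOf 8192 = {13} := by decide +kernel

/-- The mask `2¹⁴` opens exactly `f`. [folklore] -/
theorem tOf_f : cmD.tOf 16384 = {14} := by decide +kernel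

/-- The mask `2¹² − 1` opens exactly the first twelve pairs. [folklore] -/
theorem tOf_mu : cmD.tOf 4095 = cmD.firstT 12 := by decide +kernel

/-- The first thirteen pairs are the first twelve and the keystone. [folklore] -/
theorem firstT_thirteen : cmD.firstT 13 = insert 12 (cmD.firstT 12) := by decide +kernel

/-- `conf` of a singleton. [folklore] -/
theorem conf_singleton (i : Fin 15) : cmD.conf {i} = {cmD.edge i} := by
  unfold RCEval.conf; rw [Finset.image_singleton, Finset.coe_singleton]

/-- Setting the bit of `e`: `conf (tOf (a ||| 2¹³)) = conf (tOf a) ∪ {e}`. [folklore] -/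
theorem conf_lor_e (a : ℕ) : cmD.conf (cmD.tOf (Nat.lor a 8192)) = insert s((0 : Fin 9), 1) (cmD.conf (cmD.tOf a)) := by
  rw [tOf_lor, conf_union, tOf_e, conf_singleton, edge_thirteen, Set.union_singleton]

/-- Setting the bit of `f`. [folklore] -/
theorem conf_lor_f (a : ℕ) : cmD.conf (cmD.tOf (Nat.lor a 16384)) = insert s((0 : Fin 9), 4) (cmD.conf (cmD.tOf a)) := by
  rw [tOf_lor, conf_union, tOf_f, conf_singleton, edge_fourteen, Set.union_singleton]

/-- Setting the bit of `g` (written on the left, as in the general bridge). [folklore] -/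
theorem conf_lor_g (a : ℕ) : cmD.conf (cmD.tOf (Nat.lor 4096 a)) = insert s((7 : Fin 9), 8) (cmD.conf (cmD.tOf a)) := by
  rw [tOf_lor, conf_union, tOf_g, conf_singleton, edge_twelve, Set.union_comm, Set.union_singleton]

/-- `e, f ∉` any sub-configuration of the first 13 pairs. [folklore] -/
theorem e_f_notMem {t : Finset (Fin 15)} (ht : t ⊆ cmD.firstT 13) :
    s((0 : Fin 9), 1) ∉ cmD.conf t ∧ s((0 : Fin 9), 4) ∉ cmD.conf t := by
  rw [← edge_thirteen, ← edge_fourteen, edge_mem_conf valid, edge_mem_conf valid]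
  constructor
  · intro h; have := (mem_firstT 13 _).1 (ht h); simp at this
  · intro h; have := (mem_firstT 13 _).1 (ht h); simp at this

/-! ### The Booleans -/
section Reading
/-- `bad` indicator on the top fibre: `ω ∪ {e,f}` and the partner are forests. (this file's certificate) -/
def bA (a : ℕ) : Bool := cmD.forestB (Nat.lor (Nat.lor a 8192) 16384) && cmD.forestB (Nat.xor 8191 a)

/-- `good` indicator on the top fibre: `ω ∪ {e}` and the partner `∪ {f}` are forests. (this file's certificate) -/
def gA (a : ℕ) : Bool := cmD.forestB (Nat.lor a 8192) && cmD.forestB (Nat.lor (Nat.xor 8191 a) 16384)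

/-- `bad` indicator on the pinned fibre (`g` in both): masks `a ⊆ 4095`. (this file's certificate) -/
def bB (a : ℕ) : Bool :=
  Nat.beq (Nat.land a 4095) a && (cmD.forestB (Nat.lor (Nat.lor (Nat.lor 4096 a) 8192) 16384) && cmD.forestB (Nat.lor 4096 (Nat.xor 4095 a)))

/-- `good` indicator on the pinned fibre. (this file's certificate) -/
def gB (a : ℕ) : Bool :=
  Nat.beq (Nat.land a 4095) a && (cmD.forestB (Nat.lor (Nat.lor 4096 a) 8192) && cmD.forestB (Nat.lor (Nat.lor 4096 (Nat.xor 4095 a)) 16384))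

/-- Summand of the top-fibre sum. (this file's certificate) -/
def FA (a : ℕ) : ℕ := cond (bA a) 1 0 + 16384 * cond (gA a) 1 0

/-- Summand of the pinned-fibre sum. (this file's certificate) -/
def FB (a : ℕ) : ℕ := cond (bB a) 1 0 + 65536 * cond (gB a) 1 0

/-- Top fibre, chunks of `2¹¹`. (this file's `decide +kernel` evaluations) -/
theorem sumR_FA_0 : sumR FA 11 0 = 1900636 := by decide +kernel
/-- (chunk) -/
theorem sumR_FA_1 : sumR FA 11 2048 = 2424980 := by decide +kernel
/-- (chunk) -/
theorem sumR_FA_2 : sumR FA 11 4096 = 2752678 := by decide +kernel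
/-- (chunk) -/
theorem sumR_FA_3 : sumR FA 11 6144 = 1572984 := by decide +kernel

/-- **`Σ_{a < 2¹³} FA a = 8651278 = 526 + 2¹⁴·528`.** (this file's `decide +kernel` evaluation) -/
theorem sumR_FA : sumR FA 13 0 = 8651278 := by
  rw [sumR_split FA (show 13 = 12 + 1 by norm_num) (show 4096 = 0 + 2 ^ 12 by norm_num),
    sumR_split FA (show 12 = 11 + 1 by norm_num) (show 2048 = 0 + 2 ^ 11 by norm_num),
    sumR_split FA (show 12 = 11 + 1 by norm_num) (show 6144 = 4096 + 2 ^ 11 by norm_num),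
    sumR_FA_0, sumR_FA_1, sumR_FA_2, sumR_FA_3]

/-- Pinned fibre, chunks (no mask `⊆ 4095` beyond `2¹²`: those chunks vanish). (this file's `decide +kernel` evaluations) -/
theorem sumR_FB_0 : sumR FB 11 0 = 3932204 := by decide +kernel
/-- (chunk) -/
theorem sumR_FB_1 : sumR FB 11 2048 = 2621492 := by decide +kernel
/-- (chunk) -/
theorem sumR_FB_2 : sumR FB 12 4096 = 0 := by decide +kernel
/-- (chunk) -/
theorem sumR_FB_3 : sumR FB 13 8192 = 0 := by decide +kernel
/-- (chunk) -/
theorem sumR_FB_4 : sumR FB 14 16384 = 0 := by decide +kernel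

/-- **`Σ_{a < 2¹⁵} FB a = 6553696 = 96 + 2¹⁶·100`.** (this file's `decide +kernel` evaluation) -/
theorem sumR_FB : sumR FB 15 0 = 6553696 := by
  rw [sumR_split FB (show 15 = 14 + 1 by norm_num) (show 16384 = 0 + 2 ^ 14 by norm_num),
    sumR_split FB (show 14 = 13 + 1 by norm_num) (show 8192 = 0 + 2 ^ 13 by norm_num),
    sumR_split FB (show 13 = 12 + 1 by norm_num) (show 4096 = 0 + 2 ^ 12 by norm_num),
    sumR_split FB (show 12 = 11 + 1 by norm_num) (show 2048 = 0 + 2 ^ 11 by norm_num),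
    sumR_FB_0, sumR_FB_1, sumR_FB_2, sumR_FB_3, sumR_FB_4]

variable {a : ℕ}

/-- The evaluator decides `IsForestCfg`. [cite: Grimmett2006, §1.5 (p. 13)] -/
theorem forestB_iff' : cmD.forestB a = true ↔ IsForestCfg (cmD.conf (cmD.tOf a)) := forestB_iff (D := cmD) a valid noloop
end Reading

/-! ### Reading the guarded events as Booleans -/
section Iffs
/-- `g = s(7,8)` differs from `e, f` and `e ≠ f`. [folklore] -/
theorem g_ne : (s((7 : Fin 9), 8) ≠ s((0 : Fin 9), 1)) ∧ (s((7 : Fin 9), 8) ≠ s((0 : Fin 9), 4)) ∧ (s((0 : Fin 9), 1) ≠ s((0 : Fin 9), 4)) := by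
  refine ⟨?_, ?_, ?_⟩ <;> decide

/-- Top fibre, `bad`: the pair of guarded events is `bA`. [cite: Linusson2011, Prop. 2.6] -/
theorem badA_iff (a : ℕ) (ha : a < 2 ^ 13) :
    (cmD.conf (cmD.tOf a) ∈ ({ω | s((0 : Fin 9), 1) ∉ ω ∧ s((0 : Fin 9), 4) ∉ ω} ∩
          {ω | insert s((0 : Fin 9), 4) (insert s((0 : Fin 9), 1) ω) ∈ forestEv (Fin 9)}) ∧
        cmD.conf (cmD.tOf (Nat.xor (2 ^ 13 - 1) a)) ∈ ({ω | s((0 : Fin 9), 1) ∉ ω ∧ s((0 : Fin 9), 4) ∉ ω} ∩ forestEv (Fin 9))) ↔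
      bA a = true := by
  have hx : Nat.xor (2 ^ 13 - 1) a = Nat.xor 8191 a := by norm_num
  obtain ⟨heA, hfA⟩ := e_f_notMem (tOf_subset_firstT (D := cmD) ha)
  obtain ⟨heB, hfB⟩ := e_f_notMem (t := cmD.tOf (Nat.xor 8191 a)) (by rw [← hx, tOf_xor 13 a ha]; exact Finset.sdiff_subset)
  rw [hx]
  simp only [Set.mem_inter_iff, Set.mem_setOf_eq, forestEv, bA, Bool.and_eq_true, forestB_iff', conf_lor_f, conf_lor_e]
  tauto

/-- Top fibre, `good`: the pair of guarded events is `gA`. [cite: Linusson2011, Prop. 2.6] -/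
theorem goodA_iff (a : ℕ) (ha : a < 2 ^ 13) :
    (cmD.conf (cmD.tOf a) ∈ ({ω | s((0 : Fin 9), 1) ∉ ω ∧ s((0 : Fin 9), 4) ∉ ω} ∩ {ω | insert s((0 : Fin 9), 1) ω ∈ forestEv (Fin 9)}) ∧
        cmD.conf (cmD.tOf (Nat.xor (2 ^ 13 - 1) a)) ∈
          ({ω | s((0 : Fin 9), 1) ∉ ω ∧ s((0 : Fin 9), 4) ∉ ω} ∩ {ω | insert s((0 : Fin 9), 4) ω ∈ forestEv (Fin 9)})) ↔
      gA a = true := by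
  have hx : Nat.xor (2 ^ 13 - 1) a = Nat.xor 8191 a := by norm_num
  obtain ⟨heA, hfA⟩ := e_f_notMem (tOf_subset_firstT (D := cmD) ha)
  obtain ⟨heB, hfB⟩ := e_f_notMem (t := cmD.tOf (Nat.xor 8191 a)) (by rw [← hx, tOf_xor 13 a ha]; exact Finset.sdiff_subset)
  rw [hx]
  simp only [Set.mem_inter_iff, Set.mem_setOf_eq, forestEv, gA, Bool.and_eq_true, forestB_iff', conf_lor_f, conf_lor_e]
  tauto

/-- Under `a ⊆ 4095` the masks `a` and `4095 ⊕ a` open only the first twelve pairs. [folklore] -/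
theorem sub_twelve {a : ℕ} (h : Nat.land a 4095 = a) :
    cmD.tOf a ⊆ cmD.firstT 13 ∧ cmD.tOf (Nat.xor 4095 a) ⊆ cmD.firstT 13 := by
  have h12 : cmD.firstT 12 ⊆ cmD.firstT 13 := fun i hi => (mem_firstT 13 i).2 (Nat.lt_succ_of_lt ((mem_firstT 12 i).1 hi))
  have ha : cmD.tOf a ⊆ cmD.firstT 12 := tOf_mu ▸ tOf_subset_of_land_eq h
  refine ⟨ha.trans h12, ?_⟩
  rw [tOf_xor_of_land_eq h, tOf_mu]
  exact Finset.sdiff_subset.trans h12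

/-- `e, f, ∉ {g} ∪` a configuration of the first twelve pairs. [folklore] -/
theorem e_f_notMem_insert_g {t : Finset (Fin 15)} (ht : t ⊆ cmD.firstT 13) :
    s((0 : Fin 9), 1) ∉ insert s((7 : Fin 9), 8) (cmD.conf t) ∧ s((0 : Fin 9), 4) ∉ insert s((7 : Fin 9), 8) (cmD.conf t) := by
  obtain ⟨he, hf⟩ := e_f_notMem ht
  obtain ⟨hge, hgf, -⟩ := g_ne
  simp only [Set.mem_insert_iff, not_or]
  exact ⟨⟨fun h => hge h.symm, he⟩, ⟨fun h => hgf h.symm, hf⟩⟩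

/-- Pinned fibre, `bad`: the triple of conditions of the general bridge is `bB`. [cite: Linusson2011, Prop. 2.6] -/
theorem badB_iff (a : ℕ) (_ha : a < 2 ^ cmD.m) :
    ((Nat.land a 4095 = a ∧
        cmD.conf (cmD.tOf (Nat.lor 4096 a)) ∈ ({ω | s((0 : Fin 9), 1) ∉ ω ∧ s((0 : Fin 9), 4) ∉ ω} ∩
          {ω | insert s((0 : Fin 9), 4) (insert s((0 : Fin 9), 1) ω) ∈ forestEv (Fin 9)}) ∧
        cmD.conf (cmD.tOf (Nat.lor 4096 (Nat.xor 4095 a))) ∈ ({ω | s((0 : Fin 9), 1) ∉ ω ∧ s((0 : Fin 9), 4) ∉ ω} ∩ forestEv (Fin 9))) ↔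
      bB a = true) := by
  by_cases h : Nat.land a 4095 = a
  · obtain ⟨hA, hB⟩ := sub_twelve h
    obtain ⟨heA, hfA⟩ := e_f_notMem_insert_g hA
    obtain ⟨heB, hfB⟩ := e_f_notMem_insert_g hB
    have hbeq : Nat.beq (Nat.land a 4095) a = true := by
      cases hh : Nat.beq (Nat.land a 4095) a
      · exact absurd h (Nat.ne_of_beq_eq_false hh)
      · rfl
    simp only [Set.mem_inter_iff, Set.mem_setOf_eq, forestEv, bB, hbeq, Bool.true_and, Bool.and_eq_true, forestB_iff',
      conf_lor_f, conf_lor_e, conf_lor_g]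
    tauto
  · have hbeq : Nat.beq (Nat.land a 4095) a = false := by
      cases hh : Nat.beq (Nat.land a 4095) a
      · rfl
      · exact absurd (Nat.eq_of_beq_eq_true hh) h
    simp only [bB, hbeq, Bool.false_and]
    tauto

/-- Pinned fibre, `good`: the triple of conditions of the general bridge is `gB`. [cite: Linusson2011, Prop. 2.6] -/
theorem goodB_iff (a : ℕ) (_ha : a < 2 ^ cmD.m) :
    ((Nat.land a 4095 = a ∧
        cmD.conf (cmD.tOf (Nat.lor 4096 a)) ∈ ({ω | s((0 : Fin 9), 1) ∉ ω ∧ s((0 : Fin 9), 4) ∉ ω} ∩ {ω | insert s((0 : Fin 9), 1) ω ∈ forestEv (Fin 9)}) ∧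
        cmD.conf (cmD.tOf (Nat.lor 4096 (Nat.xor 4095 a))) ∈
          ({ω | s((0 : Fin 9), 1) ∉ ω ∧ s((0 : Fin 9), 4) ∉ ω} ∩ {ω | insert s((0 : Fin 9), 4) ω ∈ forestEv (Fin 9)})) ↔
      gB a = true) := by
  by_cases h : Nat.land a 4095 = a
  · obtain ⟨hA, hB⟩ := sub_twelve h
    obtain ⟨heA, hfA⟩ := e_f_notMem_insert_g hA
    obtain ⟨heB, hfB⟩ := e_f_notMem_insert_g hB
    have hbeq : Nat.beq (Nat.land a 4095) a = true := by
      cases hh : Nat.beq (Nat.land a 4095) a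
      · exact absurd h (Nat.ne_of_beq_eq_false hh)
      · rfl
    simp only [Set.mem_inter_iff, Set.mem_setOf_eq, forestEv, gB, hbeq, Bool.true_and, Bool.and_eq_true, forestB_iff',
      conf_lor_f, conf_lor_e, conf_lor_g]
    tauto
  · have hbeq : Nat.beq (Nat.land a 4095) a = false := by
      cases hh : Nat.beq (Nat.land a 4095) a
      · rfl
      · exact absurd (Nat.eq_of_beq_eq_true hh) h
    simp only [gB, hbeq, Bool.false_and]
    tauto
end Iffs

/-! ### The four guarded counts -/
/-- The top fibre `M_A = E(G) ∖ {e,f}` (first thirteen pairs, `g` free). [folklore] -/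
def MA : BondConfig (Fin 9) := cmD.conf (cmD.firstT 13)

/-- The pinned fibre's free part `M_B` (first twelve pairs). [folklore] -/
def MB : BondConfig (Fin 9) := cmD.conf (cmD.tOf 4095)

/-- The pinned part `{g}`. [folklore] -/
def UB : BondConfig (Fin 9) := cmD.conf (cmD.tOf 4096)

/-- `M_A = M_B ∪ {g}`. [folklore] -/
theorem MA_eq : MA = insert s((7 : Fin 9), 8) MB := by
  unfold MA MB
  rw [firstT_thirteen, Finset.insert_eq, conf_union, conf_singleton, edge_twelve, tOf_mu, Set.singleton_union]

/-- `{g} = conf (tOf 2¹²)`. [folklore] -/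
theorem UB_eq : UB = insert s((7 : Fin 9), 8) (∅ : BondConfig (Fin 9)) := by
  unfold UB
  rw [tOf_g, conf_singleton, edge_twelve]
  ext x; simp

/-- `g ∉ M_B`. [folklore] -/
theorem g_notMem_MB : s((7 : Fin 9), 8) ∉ MB := by
  unfold MB
  rw [← edge_twelve, edge_mem_conf valid, tOf_mu, mem_firstT]
  decide

/-- **Weighted two-indicator sum**: `#{g₁} + K·#{g₃} = Σ_{a<2^d} ([g₁ a] + K[g₃ a])`, and both counts are `≤ 2^d`. [folklore] -/
theorem two_counts_eq_sumR (d K : ℕ) (g₁ g₃ : ℕ → Bool) :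
    ((Finset.range (2 ^ d)).filter fun a => g₁ a = true).card + K * ((Finset.range (2 ^ d)).filter fun a => g₃ a = true).card =
        sumR (fun a => cond (g₁ a) 1 0 + K * cond (g₃ a) 1 0) d 0 ∧
      ((Finset.range (2 ^ d)).filter fun a => g₁ a = true).card ≤ 2 ^ d ∧
      ((Finset.range (2 ^ d)).filter fun a => g₃ a = true).card ≤ 2 ^ d := by
  refine ⟨?_, le_trans (Finset.card_filter_le _ _) (Finset.card_range _).le, le_trans (Finset.card_filter_le _ _) (Finset.card_range _).le⟩
  rw [Finset.card_filter, Finset.card_filter, Finset.mul_sum, ← Finset.sum_add_distrib, sumR_eq]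
  refine Finset.sum_congr rfl fun a _ => ?_
  rw [zero_add]
  cases g₁ a <;> cases g₃ a <;> simp

/-- **Top fibre counts: `bad_A + 2¹⁴·good_A = 8651278` with `bad_A, good_A ≤ 2¹³`** (i.e. `bad_A = 526`, `good_A = 528`).
[cite: Linusson2011, Prop. 2.6] -/
theorem countsA :
    fibreCount MA ∅ ({ω | s((0 : Fin 9), 1) ∉ ω ∧ s((0 : Fin 9), 4) ∉ ω} ∩
          {ω | insert s((0 : Fin 9), 4) (insert s((0 : Fin 9), 1) ω) ∈ forestEv (Fin 9)})
        ({ω | s((0 : Fin 9), 1) ∉ ω ∧ s((0 : Fin 9), 4) ∉ ω} ∩ forestEv (Fin 9)) +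
      16384 * fibreCount MA ∅ ({ω | s((0 : Fin 9), 1) ∉ ω ∧ s((0 : Fin 9), 4) ∉ ω} ∩ {ω | insert s((0 : Fin 9), 1) ω ∈ forestEv (Fin 9)})
        ({ω | s((0 : Fin 9), 1) ∉ ω ∧ s((0 : Fin 9), 4) ∉ ω} ∩ {ω | insert s((0 : Fin 9), 4) ω ∈ forestEv (Fin 9)}) = 8651278 ∧
    fibreCount MA ∅ ({ω | s((0 : Fin 9), 1) ∉ ω ∧ s((0 : Fin 9), 4) ∉ ω} ∩
          {ω | insert s((0 : Fin 9), 4) (insert s((0 : Fin 9), 1) ω) ∈ forestEv (Fin 9)})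
        ({ω | s((0 : Fin 9), 1) ∉ ω ∧ s((0 : Fin 9), 4) ∉ ω} ∩ forestEv (Fin 9)) ≤ 2 ^ 13 ∧
    fibreCount MA ∅ ({ω | s((0 : Fin 9), 1) ∉ ω ∧ s((0 : Fin 9), 4) ∉ ω} ∩ {ω | insert s((0 : Fin 9), 1) ω ∈ forestEv (Fin 9)})
        ({ω | s((0 : Fin 9), 1) ∉ ω ∧ s((0 : Fin 9), 4) ∉ ω} ∩ {ω | insert s((0 : Fin 9), 4) ω ∈ forestEv (Fin 9)}) ≤ 2 ^ 13 := by
  have h13 : (13 : ℕ) ≤ cmD.m := by decide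
  unfold MA
  rw [fibreCount_conf_eq_card_bool valid h13 bA badA_iff, fibreCount_conf_eq_card_bool valid h13 gA goodA_iff]
  have h := two_counts_eq_sumR 13 16384 bA gA
  have hS : sumR (fun a => cond (bA a) 1 0 + 16384 * cond (gA a) 1 0) 13 0 = 8651278 := sumR_FA
  rw [hS] at h
  exact h

/-- **Pinned fibre counts: `bad_B + 2¹⁶·good_B = 6553696` with `bad_B, good_B ≤ 2¹⁵`** (i.e. `bad_B = 96`, `good_B = 100`).
[cite: Linusson2011, Prop. 2.6] -/
theorem countsB :
    fibreCount MB UB ({ω | s((0 : Fin 9), 1) ∉ ω ∧ s((0 : Fin 9), 4) ∉ ω} ∩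
          {ω | insert s((0 : Fin 9), 4) (insert s((0 : Fin 9), 1) ω) ∈ forestEv (Fin 9)})
        ({ω | s((0 : Fin 9), 1) ∉ ω ∧ s((0 : Fin 9), 4) ∉ ω} ∩ forestEv (Fin 9)) +
      65536 * fibreCount MB UB ({ω | s((0 : Fin 9), 1) ∉ ω ∧ s((0 : Fin 9), 4) ∉ ω} ∩ {ω | insert s((0 : Fin 9), 1) ω ∈ forestEv (Fin 9)})
        ({ω | s((0 : Fin 9), 1) ∉ ω ∧ s((0 : Fin 9), 4) ∉ ω} ∩ {ω | insert s((0 : Fin 9), 4) ω ∈ forestEv (Fin 9)}) = 6553696 ∧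
    fibreCount MB UB ({ω | s((0 : Fin 9), 1) ∉ ω ∧ s((0 : Fin 9), 4) ∉ ω} ∩
          {ω | insert s((0 : Fin 9), 4) (insert s((0 : Fin 9), 1) ω) ∈ forestEv (Fin 9)})
        ({ω | s((0 : Fin 9), 1) ∉ ω ∧ s((0 : Fin 9), 4) ∉ ω} ∩ forestEv (Fin 9)) ≤ 2 ^ 15 ∧
    fibreCount MB UB ({ω | s((0 : Fin 9), 1) ∉ ω ∧ s((0 : Fin 9), 4) ∉ ω} ∩ {ω | insert s((0 : Fin 9), 1) ω ∈ forestEv (Fin 9)})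
        ({ω | s((0 : Fin 9), 1) ∉ ω ∧ s((0 : Fin 9), 4) ∉ ω} ∩ {ω | insert s((0 : Fin 9), 4) ω ∈ forestEv (Fin 9)}) ≤ 2 ^ 15 := by
  have hdis : Nat.land 4095 4096 = 0 := by decide
  have hm : cmD.m = 15 := rfl
  unfold MB UB
  rw [fibreCount_conf_tOf_eq_card_bool valid hdis bB badB_iff, fibreCount_conf_tOf_eq_card_bool valid hdis gB goodB_iff, hm]
  have h := two_counts_eq_sumR 15 65536 bB gB
  have hS : sumR (fun a => cond (bB a) 1 0 + 65536 * cond (gB a) 1 0) 15 0 = 6553696 := sumR_FB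
  rw [hS] at h
  exact h

/-! ### The refutation -/

/-- **`¬ AdjForestContractionMonoOn (Fin 9)`**: at the fibre `(E(G), ∅)` of the two-fan graph, pinning the keystone `g = s(7,8)` raises the
margin: `good − bad = 2` before, `4` after. [cite: SempleWelsh2008, Conj. 1.1 (p. 2)] [cite: CibulkaHladkyLaCroixWagner2008, Thm. 1 (p. 2)] -/
theorem not_adjForestContractionMonoOn_fin_nine : ¬ AdjForestContractionMonoOn (Fin 9) := by
  intro h
  obtain ⟨hge, hgf, hef⟩ := g_ne
  obtain ⟨heMA, hfMA⟩ := e_f_notMem (t := cmD.firstT 13) subset_rfl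
  have heMA' : s((0 : Fin 9), 1) ∉ MA := heMA
  have hfMA' : s((0 : Fin 9), 4) ∉ MA := hfMA
  have heMB : s((0 : Fin 9), 1) ∉ MB := fun h' => heMA' (by rw [MA_eq]; exact Set.mem_insert_of_mem _ h')
  have hfMB : s((0 : Fin 9), 4) ∉ MB := fun h' => hfMA' (by rw [MA_eq]; exact Set.mem_insert_of_mem _ h')
  have hgM : s((7 : Fin 9), 8) ∈ insert s((0 : Fin 9), 4) (insert s((0 : Fin 9), 1) MA) :=
    Or.inr (Or.inr (MA_eq ▸ Set.mem_insert _ _))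
  have key := h (insert s((0 : Fin 9), 4) (insert s((0 : Fin 9), 1) MA)) ∅ disjoint_bot_left 0 1 4 (by decide) s(7, 8) hgM hge hgf
  -- the pinned fibre is `(M_B ∪ {e,f}, {g})`
  have hMB : insert s((0 : Fin 9), 4) (insert s((0 : Fin 9), 1) MA) \ {s((7 : Fin 9), 8)} = insert s((0 : Fin 9), 4) (insert s((0 : Fin 9), 1) MB) := by
    rw [MA_eq]
    ext x
    have hx1 : x = s((7 : Fin 9), 8) → x ∉ MB := fun h' => h' ▸ g_notMem_MB
    have hx2 : x = s((7 : Fin 9), 8) → ¬ x = s((0 : Fin 9), 4) := fun h' => h' ▸ hgf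
    have hx3 : x = s((7 : Fin 9), 8) → ¬ x = s((0 : Fin 9), 1) := fun h' => h' ▸ hge
    simp only [Set.mem_sdiff, Set.mem_insert_iff, Set.mem_singleton_iff]
    tauto
  rw [hMB, ← UB_eq, fibreCount_insert_two_both heMA' hfMA', fibreCount_insert_two_one hef heMA' hfMA',
    fibreCount_insert_two_both heMB hfMB, fibreCount_insert_two_one hef heMB hfMB] at key
  obtain ⟨hA, hA1, hA2⟩ := countsA
  obtain ⟨hB, hB1, hB2⟩ := countsB
  have h13 : (2 : ℕ) ^ 13 = 8192 := by norm_num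
  have h15 : (2 : ℕ) ^ 15 = 32768 := by norm_num
  rw [h13] at hA1 hA2; rw [h15] at hB1 hB2
  omega

/-- **`¬ AdjForestContractionMonoPos`** — every-pair contraction monotonicity (this generation's node, `…ForestContractionMono`) is FALSE:
it fails on `Fin 9`.  refuted-substantive for the every-pair form; the some-pair form (hypothesis of `adjForestRayleighNoSqOn_of_exists_pinning`)
holds on the witness (all other free pairs are pinnable) and has no known failure. [cite: SempleWelsh2008, Conj. 1.1 (p. 2); Thm. 4.2 (p. 11)] -/
theorem not_adjForestContractionMonoPos : ¬ AdjForestContractionMonoPos := fun h => not_adjForestContractionMonoOn_fin_nine (h 9)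

end ContractionMonoCex

end FK

end Summit.CriticalPhenomena.PercolationContinuityZ3.Theorems
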